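import Literature.AlgebraicGeometry.ModuliOfAbelianVarieties.SiegelFineModuliSchemeOfCovariant
import Literature.AlgebraicGeometry.ModuliOfAbelianVarieties.SiegelFramedCovariantOfHilb
import Literature.AlgebraicGeometry.ModuliOfAbelianVarieties.SiegelFrameEmbeddingOverField
import Literature.AlgebraicGeometry.AbelianSchemes.PolarizedLevelPushforwardDetClass
import Literature.AlgebraicGeometry.Motives.HilbertImageInGrassmannianUniversalFamily
import Literature.AlgebraicGeometry.ModuliOfAbelianVarieties.SiegelModuliQuasiProjective
import Literature.AlgebraicGeometry.HodgeTheory.AlgebraicityLocus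
import Literature.AlgebraicGeometry.ModuliOfAbelianVarieties.SiegelFramedCovariantOfHilbPrint -- (ed. 3) ★ row 3 of the (β)+(γ) set: the covariant over the PRINT-EXACT cores
import HarnessLib

/-!
# The Siegel fine moduli scheme AT LARGE LEVEL, modulo the CORES — the F-12 assembly of the F-DAG
# ([MumfordFogartyKirwan1994] Thm. 7.9 «for `n` large», assembled from Prop. 7.6 / 7.7 and the generic cores)

Layer `Literature/AlgebraicGeometry/ModuliOfAbelianVarieties`, namespace `Literature.AlgebraicGeometry.ModuliOfAbelianVarieties`.
THEOREMS ONLY (no definition, no named fact, no instance, no notation, no `sorry`).  Cell `hodgecm-mathlib` (D-0151), F-DAG row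
F-12 (author B-p11 (g18); word B-plan1 (g17) 10:03:57Z / 10:13:00Z, director s238; census
`B-provers/B-p11/g18/CENSUS-F12-AssemblyModuloCores.B-p11g18.md`, dev cert 27e92bce45e74b50, G-device A-p04 (g18) v0/v1).
COUNT-NEUTRAL: HC_CM is proved only modulo the 7 printed citations until rung 0 closes; this file DISCHARGES NO BINDER — it
states precisely WHICH generic theorems («cores») the large-level moduli theorem `stub_Flarge` of the registry
(`Summits/…/Cruxes/HDel/Lines/F1ExtHodgeType.lean` :214–221) rests on, and proves the implication.

## The statement (EDITION 1)

`exists_threshold_siegelFineModuliScheme_of_cores`: GIVEN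
* `hHilb : HHilb`, `hII : HII` — the Hilbert-scheme core (F-5, [MumfordFogartyKirwan1994] Ch. 0 §5 (c)) and the
  abelian-scheme-locus core (F-4, [MumfordFogartyKirwan1994] Thm. 6.14 with the group law as DATA, the letter of ★
  `AbelianSchemeOver.exists_isImmersion_iff_mfkSubfunctor`'s binder `hII`), as PARAMETERS `HHilb HII : Prop`: in this edition
  they enter ONLY through `hHrep`;
* `hF3` — the dual-abelian-scheme core (F-3, [MumfordFogartyKirwan1994] Cor. 6.8 Zariski-locally on the base, letter (L) = the
  binder `hdual` of ★ `exists_glued_of_representedCharts_of_specHom` / ★ `SiegelFramedCovariant.exists_siegelFineModuliScheme`);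
* `hF9a` — the frame-count core (F-9 (9a), [MumfordFogartyKirwan1994] Prop. 7.7: for `N ≥ β(g, δ)` every triple over an
  algebraically closed field OF CHARACTERISTIC `0` is `R`-framed for some `(m+2)`-tuple `R` of torsion indices; ℚ-relative
  letter — the tree's frame producers are characteristic-`0` capital) — THE ONLY PLACE THE THRESHOLD `β` ENTERS;
* `hF9` — the quasi-projectivity core (F-9 (9b)–(9d), [MumfordFogartyKirwan1994] Thm. 7.9 «quasi-projective» with Ch. 3 §1 /
  Prop. 7.1: the glued `A⁰ = ⋃_R V_R` and its universal family are quasi-projective over ℚ), in the CONCRETE `𝓗`-form (it consumes the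
  covariant `𝓗`, its finite type, the Plücker clause `PL 𝓗` — a PARAMETER `PL : SiegelFramedCovariant g N δ J → Prop` in this
  edition — and the chart structure of `A⁰` BY THE STANDARD-FRAME SLICES `V_R ⊂ H` exactly as ★
  `SiegelFramedCovariant.exists_siegelFineModuliScheme` outputs it: open immersions `j R`, chart relations, overlaps = frame opens,
  joint surjectivity);
* `hF11` — the smoothness core (F-11, [Lan2013PELCompactifications] §2.2.4: every fine moduli scheme `𝓜` of the Siegel functor
  that is locally of finite type over ℚ is smooth over ℚ; B-p13 (g20)'s census form);
* `hHrep` — IN-FLIGHT, NOT A CORE (edition-1 binder, dropped in edition 2): the linearly rigidified covariant EXISTS, is locally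
  of finite type, satisfies the unit hypothesis of its Poincaré sheaf and `PL` — [MumfordFogartyKirwan1994] Prop. 7.3 with
  Def. 7.5 / Prop. 7.6; in the tree = the head of (H-rep) `SiegelFramedCovariantOfHilb` (B-p18 (g19), upstream (R3) + (R-L)),
  whose own inputs are exactly `hHilb`, `hII`, `hF3`;
THEN `stub_Flarge` VERBATIM: `∃ β, ∀ g N δ, 0 < g → IsPolarizationType δ → 3 ≤ N → β g δ ≤ N → ∃ 𝓜 : SiegelFineModuliScheme g N δ,
Smooth 𝓜.M.hom ∧ IsQuasiProjectiveOver 𝓜.M ∧ IsQuasiProjectiveOver (Over.mk (𝓜.univ.A.X.hom ≫ 𝓜.M.hom))`.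

Road (25 lines, every step ★ BY NAME): `β := hF9a`'s threshold; `J := Fin (6^g·d − 1)` (`Nat.card J + 1 = 6^g·d`); `hHrep` gives the
covariant `𝓗`; ★ `SiegelFramedCovariant.exists_siegelFineModuliScheme` (B-p08 (g13): (8ε) ⊕ (8γ) ⊕ (8δ) ⊕ (8β) ⊕ (F4) — MFK Prop. 7.6)
fed with `hcov := hF9a` at this `N` and `hdual := hF3` gives `𝓜` WITH its chart structure by the standard-frame slices `V_R ⊂ H`;
`hF9` gives the two quasi-projectivity clauses; ★ `HodgeTheory.locallyOfFiniteType_of_isQuasiProjectiveOver` gives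
`LocallyOfFiniteType 𝓜.M.hom`; `hF11` gives smoothness.  Level DESCENT to every `N ≥ 3` is NOT here: it is ★
`lan2013_siegelFineModuliScheme_of_large_levels` (F-10), applied by the registry.

## The statement (EDITION 2, appended; edition 1 unchanged)

`exists_threshold_siegelFineModuliScheme_of_cores'`: the in-flight binder `hHrep` is DISSOLVED — the covariant comes BY NAME from ★ R-C2
`exists_siegelFramedCovariant_locallyOfFiniteType_of_cores` ([MumfordFogartyKirwan1994] Prop. 7.3 / 7.6; its unit hypothesis is the field
`hatNormalised` of edition 2 of ★ `PolarizedAbelianSchemeWithLevel`), `hF9a` is ★ `exists_threshold_forall_exists_isFrameOn` BY NAME, the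
parameters `HII PL` become the cell's letters (`hII` = Thm. 6.14 with the group law as data;
`PL` = the named constant ★ `SiegelFramedCovariant.PL`), and the only residue of (H-rep) is the print-located Plücker letter `hPL`
([MumfordFogartyKirwan1994] Prop. 7.4 with §7.2 (*) / Def. 7.5 / Prop. 6.13 (ii)(iv)); the Hilbert-scheme core `HHilb` is ★ F-5 ⑦b
`Motives.exists_grassmannianImmersion_universal_flat_family` BY NAME and the quasi-projectivity core `hF9` is ★
`SiegelFineModuliScheme.isQuasiProjectiveOver_of_charts_of_PL` BY NAME.  Binders: `hII hF3 hPL hF11` ⊢ `stub_Flarge`.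

## The statement (EDITION 3, appended; editions 1–2 unchanged)

`exists_threshold_siegelFineModuliScheme_of_cores''`: the same conclusion (`stub_Flarge` verbatim) with the step-(II) core in its PRINT-EXACT
letter `hII''` = «for every `g`, [MumfordFogartyKirwan1994] Prop. 6.16 ∕ Thm. 6.14 for a PROJECTIVE smooth `p₁ : Z₁ → H₁` with geometrically
connected fibres and a section: the locus of abelian-scheme structures of relative dimension `g` is an OPEN `H₂ ↪ H₁` carrying the universal law»
(binder `(_ : IsProjective p₁)`, NO closedness conjunct — the (β)+(γ) edition set of the cell, rows 1–3 ★: FILE 2 ed. 2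
`AbelianSchemeOver.exists_isImmersion_iff_mfkSubfunctor'`, R-A ed. 4 `exists_siegelUniversalTriple_clauses_iff_mfkIntrinsic'`, and the NEW
★ `SiegelFramedCovariantOfHilbPrint`), which with `∀ (g : ℕ)` in front is the statement of the cell's F-4 theorem (tree
`Cruxes/HDel/Lines/F4LinearRigidificationII.lean` `stub_IIrep'`); `hF3`, `hPL`, `hF11` are the binders of edition 2 UNCHANGED (the dual-pair core
stays Zariski-local, letter (L)); the covariant now comes BY NAME from ★ `exists_siegelFramedCovariant_locallyOfFiniteType_of_printCores'`
(which consumes the Hilbert-scheme core ★ `Motives.exists_grassmannianImmersion_universal_flat_family` itself), fed `hII'' g` and the print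
dual-pair letter hF3′ («the dual of a PROJECTIVE abelian scheme over a locally Noetherian `ℚ`-base exists», Ch. 0 §5 (d) + Cor. 6.8) DERIVED
from `hF3` on the trivial Zariski cover (★ `AbelianSchemeOver.IsBaseChangeVia.refl`).  Binders: `hII'' hF3 hPL hF11` ⊢ `stub_Flarge`.

## References
* [MumfordFogartyKirwan1994] D. Mumford, J. Fogarty, F. Kirwan, *Geometric Invariant Theory*, 3rd ed. (1994): Ch. 0 §5 (c) (pp. 23–24);
  Ch. 6 §1 Cor. 6.8 (p. 118), §2 Prop. 6.13 (p. 123), §3 Thm. 6.14 (p. 124); Ch. 7 §2 (*) (p. 131), Prop. 7.3 (p. 132), Prop. 7.4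
  (p. 135), Def. 7.5 (p. 130), Prop. 7.6 (p. 136), §3 Prop. 7.7 (p. 138), Thm. 7.9 with the remark following it and Thm. 7.10 (p. 139).
* [Mumford1966CurvesSurface] D. Mumford, *Lectures on curves on an algebraic surface* (1966), Lecture 15 (pp. 106–108).
* [Lan2013PELCompactifications] K.-W. Lan, *Arithmetic compactifications of PEL-type Shimura varieties* (2013): Thm. 1.4.1.11 (p. 91),
  §2.2.4 (pp. 142–150).
-/

noncomputable section

-- the `Over`-category structure maps of ★ `baseChange` are not reducible (as in ★ `SiegelFineModuliSchemeOfCovariant`).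
set_option backward.isDefEq.respectTransparency false

open CategoryTheory CategoryTheory.Limits AlgebraicGeometry TopologicalSpace
open Literature.AlgebraicGeometry.AbelianSchemes Literature.AlgebraicGeometry.Motives
open Literature.AlgebraicGeometry.Morphisms (IsProjective projectiveSpaceInt)
open Literature.AlgebraicGeometry.Morphisms.ProjFrame (frameDetSection slice sliceι)
open Literature.AlgebraicGeometry.ProjectiveSpace.ProjFrame (stdChart)
open Literature.AlgebraicGeometry.HodgeTheory (IsQuasiProjectiveOver locallyOfFiniteType_of_isQuasiProjectiveOver)

namespace Literature.AlgebraicGeometry.ModuliOfAbelianVarieties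

open PolarizedAbelianSchemeWithLevel AbelianSchemeOver

/-- **[MumfordFogartyKirwan1994] Thm. 7.9 «for `n` large» MODULO THE CORES (edition 1).**  For some threshold `β (g, δ)`, at every
level `N ≥ 3` with `β g δ ≤ N` the Siegel moduli functor of type `δ` is represented by a fine moduli scheme `𝓜` over ℚ with
`𝓜.M → Spec ℚ` smooth, `𝓜.M` quasi-projective over ℚ and the universal abelian scheme's total space quasi-projective over ℚ —
GIVEN the cores `hHilb` (F-5 Hilbert scheme), `hII` (F-4 abelian-scheme locus, group law as data), `hF3` (F-3 dual abelian scheme,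
Cor. 6.8 Zariski-locally), `hF9a` (F-9a frame count Prop. 7.7, characteristic `0`, carries `β`), `hF9` (F-9 quasi-projectivity of the
slice-glued scheme and its universal family), `hF11` (F-11 smoothness of l.f.t. fine moduli schemes) and, in THIS edition, the
in-flight covariant theorem `hHrep` (Prop. 7.3 / (H-rep), whose inputs are `hHilb hII hF3`; `HHilb`, `HII`, `PL` are parameters
entering only through `hHrep` / `hF9`).  Conclusion = `stub_Flarge` of registry 24835 v5.4 verbatim.  Proof: `J := Fin (6^g·d − 1)`,
★ `SiegelFramedCovariant.exists_siegelFineModuliScheme` (Prop. 7.6 by slices) with `hcov := hF9a`, then `hF9`, ★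
`locallyOfFiniteType_of_isQuasiProjectiveOver`, `hF11`.
[cite: MumfordFogartyKirwan1994, Ch. 7 §3 Theorem 7.9 with the remark following it and Theorem 7.10 (p. 139)]
[cite: MumfordFogartyKirwan1994, Ch. 7 §2 Proposition 7.6 (p. 136) and §3 Proposition 7.7 (p. 138)]
[cite: MumfordFogartyKirwan1994, Ch. 7 §2 Proposition 7.3 (p. 132) and Definition 7.5 (p. 130)]
[cite: Lan2013PELCompactifications, Thm. 1.4.1.11 (p. 91) and §2.2.4 (pp. 142–150)] -/
theorem exists_threshold_siegelFineModuliScheme_of_cores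
    (HHilb HII : Prop) (PL : ∀ ⦃g N : ℕ⦄ ⦃δ : Fin g → ℕ⦄ ⦃J : Type⦄, SiegelFramedCovariant g N δ J → Prop)
    -- (H-rep), IN FLIGHT (edition-1 binder): the covariant with its finite type, unit hypothesis and Plücker clause
    (hHrep : ∀ (g N : ℕ) (δ : Fin g → ℕ) (J : Type) [Finite J] [NeZero N], 0 < g → IsPolarizationType δ →
      Nat.card J + 1 = 6 ^ g * polarizationDegree δ → HHilb → HII →
      (∀ ⦃S : Scheme.{0}⦄ [IsLocallyNoetherian S] (_fS : S ⟶ Spec (.of ℚ)) (A : AbelianSchemeOver S),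
        (∀ s : S, ∃ (U : Scheme.{0}) (i : U ⟶ S) (_ : IsOpenImmersion i) (_ : s ∈ Set.range i.base)
          (B : AbelianSchemeOver U) (G : B.X.left ⟶ A.X.left), B.IsBaseChangeVia A i G ∧ IsProjective B.X.hom) →
        Nonempty A.DualPair) →
      ∃ 𝓗 : SiegelFramedCovariant g N δ J, LocallyOfFiniteType 𝓗.H.hom ∧
        Nonempty ((Scheme.Modules.pullback (DualPair.unitHatSlice 𝓗.univ.D)).obj 𝓗.univ.D.P ≅ SheafOfModules.unit _) ∧
        PL 𝓗)
    -- the six cores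
    (hHilb : HHilb) (hII : HII)
    (hF3 : ∀ ⦃S : Scheme.{0}⦄ [IsLocallyNoetherian S] (_fS : S ⟶ Spec (.of ℚ)) (A : AbelianSchemeOver S),
      (∀ s : S, ∃ (U : Scheme.{0}) (i : U ⟶ S) (_ : IsOpenImmersion i) (_ : s ∈ Set.range i.base)
        (B : AbelianSchemeOver U) (G : B.X.left ⟶ A.X.left), B.IsBaseChangeVia A i G ∧ IsProjective B.X.hom) →
      Nonempty A.DualPair)
    (hF9a : ∃ β : (g : ℕ) → (Fin g → ℕ) → ℕ, ∀ (g N : ℕ) (δ : Fin g → ℕ) (J : Type) [Finite J],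
      0 < g → IsPolarizationType δ → 3 ≤ N → Nat.card J + 1 = 6 ^ g * polarizationDegree δ → β g δ ≤ N →
      ∀ ⦃Ω : Type⦄ [Field Ω] [IsAlgClosed Ω] (_ : Spec (.of Ω) ⟶ Spec (.of ℚ))
        (Q : PolarizedAbelianSchemeWithLevel g N δ (Spec (.of Ω))),
        ∃ R : Fin (Nat.card J + 2) → (Fin g ⊕ Fin g → ZMod N), IsFrameOn J Q R)
    (hF9 : ∀ (g N : ℕ) (δ : Fin g → ℕ) (J : Type) [Finite J], 0 < g → IsPolarizationType δ → 3 ≤ N →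
      Nat.card J + 1 = 6 ^ g * polarizationDegree δ →
      ∀ (𝓗 : SiegelFramedCovariant g N δ J), LocallyOfFiniteType 𝓗.H.hom → PL 𝓗 →
      ∀ (𝓜 : SiegelFineModuliScheme g N δ)
        (j : ∀ R : Fin (Nat.card J + 2) → (Fin g ⊕ Fin g → ZMod N),
          slice (fun k => (𝓗.H.left.basicOpen (frameDetSection (markedTuple J 𝓗.univ 𝓗.emb R) (stdChart (Nat.card J)))).ι ≫
            markedTuple J 𝓗.univ 𝓗.emb R k) (stdChart (Nat.card J)) (𝓗.preU_ι_markedTuple_stdChart_eq_top R) ⟶ 𝓜.M.left)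
        (_ : ∀ R, IsOpenImmersion (j R))
        (_ : ∀ R, j R ≫ 𝓜.M.hom = (sliceι _ _ (𝓗.preU_ι_markedTuple_stdChart_eq_top R) ≫
          (𝓗.H.left.basicOpen (frameDetSection (markedTuple J 𝓗.univ 𝓗.emb R) (stdChart (Nat.card J)))).ι) ≫ 𝓗.H.hom)
        (Gc : ∀ R, (𝓗.univ.baseChange (sliceι _ _ (𝓗.preU_ι_markedTuple_stdChart_eq_top R) ≫
          (𝓗.H.left.basicOpen (frameDetSection (markedTuple J 𝓗.univ 𝓗.emb R) (stdChart (Nat.card J)))).ι)).A.X.left ⟶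
            𝓜.univ.A.X.left)
        (Ĝc : ∀ R, (𝓗.univ.baseChange (sliceι _ _ (𝓗.preU_ι_markedTuple_stdChart_eq_top R) ≫
          (𝓗.H.left.basicOpen (frameDetSection (markedTuple J 𝓗.univ 𝓗.emb R) (stdChart (Nat.card J)))).ι)).D.hat.X.left ⟶
            𝓜.univ.D.hat.X.left),
        (∀ R, (𝓗.univ.baseChange (sliceι _ _ (𝓗.preU_ι_markedTuple_stdChart_eq_top R) ≫
            (𝓗.H.left.basicOpen (frameDetSection (markedTuple J 𝓗.univ 𝓗.emb R) (stdChart (Nat.card J)))).ι)).IsBaseChangeVia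
              𝓜.univ (j R) (Gc R) (Ĝc R)) →
        (∀ R R', (j R') ⁻¹ᵁ (j R).opensRange =
            frameOpen J (𝓗.univ.baseChange (sliceι _ _ (𝓗.preU_ι_markedTuple_stdChart_eq_top R') ≫
              (𝓗.H.left.basicOpen (frameDetSection (markedTuple J 𝓗.univ 𝓗.emb R') (stdChart (Nat.card J)))).ι)) R) →
        ⨆ R, (j R).opensRange = ⊤ →
        IsQuasiProjectiveOver 𝓜.M ∧ IsQuasiProjectiveOver (Over.mk (𝓜.univ.A.X.hom ≫ 𝓜.M.hom) : SchemeOver ℚ))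
    (hF11 : ∀ (g N : ℕ) (δ : Fin g → ℕ), 0 < g → IsPolarizationType δ → 3 ≤ N →
      ∀ 𝓜 : SiegelFineModuliScheme g N δ, LocallyOfFiniteType 𝓜.M.hom → Smooth 𝓜.M.hom) :
    ∃ β : (g : ℕ) → (Fin g → ℕ) → ℕ, ∀ (g N : ℕ) (δ : Fin g → ℕ), 0 < g →
      Literature.AlgebraicGeometry.ModuliOfAbelianVarieties.IsPolarizationType δ → 3 ≤ N → β g δ ≤ N →
      ∃ 𝓜 : Literature.AlgebraicGeometry.ModuliOfAbelianVarieties.SiegelFineModuliScheme g N δ,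
        AlgebraicGeometry.Smooth 𝓜.M.hom ∧ Literature.AlgebraicGeometry.HodgeTheory.IsQuasiProjectiveOver 𝓜.M ∧
          Literature.AlgebraicGeometry.HodgeTheory.IsQuasiProjectiveOver
            (CategoryTheory.Over.mk (CategoryTheory.CategoryStruct.comp 𝓜.univ.A.X.hom 𝓜.M.hom) :
              Literature.AlgebraicGeometry.Motives.SchemeOver ℚ) := by
  obtain ⟨β, hβ⟩ := hF9a
  refine ⟨β, fun g N δ hg hδ hN hβN => ?_⟩
  haveI : NeZero N := ⟨by omega⟩
  -- `J := Fin (6^g·d − 1)`, so that `#J + 1 = 6^g·d` (B-p06 (g13))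
  have hJ : Nat.card (Fin (6 ^ g * polarizationDegree δ - 1)) + 1 = 6 ^ g * polarizationDegree δ := by
    have hd : 0 < polarizationDegree δ := Finset.prod_pos fun i _ ↦ hδ.1 i
    rw [Nat.card_eq_fintype_card, Fintype.card_fin]
    exact Nat.sub_add_cancel (Nat.one_le_iff_ne_zero.mpr (Nat.pos_iff_ne_zero.mp (by positivity)))
  -- the covariant (Prop. 7.3, (H-rep)), from the three F-6-side cores
  obtain ⟨𝓗, hft, unitH, hPl⟩ := hHrep g N δ (Fin (6 ^ g * polarizationDegree δ - 1)) hg hδ hJ hHilb hII hF3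
  haveI := 𝓗.isLocallyNoetherian
  -- F-8 (Prop. 7.6 by slices): the fine moduli scheme `A⁰ = ⋃_R V_R` with its chart structure; `hcov := hF9a` at this `N`
  obtain ⟨𝓜, j, hj, hjq, Gc, Ĝc, hchart, hglue, hjcov⟩ := 𝓗.exists_siegelFineModuliScheme hJ hN hδ unitH
    (fun Ω _ _ x Q => hβ g N δ _ hg hδ hN hJ hβN x Q) hF3
  -- F-9: quasi-projectivity of `𝓜.M` and of the universal total space, on the chart structure by the slices
  obtain ⟨hqM, hqU⟩ := hF9 g N δ _ hg hδ hN hJ 𝓗 hft hPl 𝓜 j hj hjq Gc Ĝc hchart hglue hjcov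
  -- F-11: smoothness; `𝓜.M` is locally of finite type over ℚ because it is quasi-projective
  haveI : LocallyOfFiniteType 𝓜.M.hom := locallyOfFiniteType_of_isQuasiProjectiveOver hqM
  exact ⟨𝓜, hF11 g N δ hg hδ hN 𝓜 inferInstance, hqM, hqU⟩

/-! ## Edition 2 — `hHrep` DISSOLVED (R2⁺ `hatNormalised` + ★ R-C1 + ★ R-C2) into its print-located residue `hPL`

`exists_threshold_siegelFineModuliScheme_of_cores'`: the same conclusion (`stub_Flarge` verbatim) from the FOUR printed cores
`hII` ([MumfordFogartyKirwan1994] Thm. 6.14), `hF3` (Cor. 6.8), `hPL` (Prop. 7.4 with §7.2 (*) / Def. 7.5 / Prop. 6.13 (ii)(iv): the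
Plücker letter of the linearly rigidified covariant), `hF11` (smoothness); the quasi-projectivity core F-9 (Thm. 7.9 / Prop. 7.6 by
slices) is NO LONGER A BINDER: it is ★ `SiegelFineModuliScheme.isQuasiProjectiveOver_of_charts_of_PL` BY NAME (consuming the NAMED
constant ★ `SiegelFramedCovariant.PL`); the Hilbert-scheme core is NO LONGER A BINDER either: it is ★ F-5 ⑦b
`Motives.exists_grassmannianImmersion_universal_flat_family` BY NAME (the Hilbert scheme `Hilb^P_{𝐏^J} ↪ Gr` with its universal closed
flat family, [Mumford1966CurvesSurface] Lect. 15, [MumfordFogartyKirwan1994] Ch. 0 §5 (c)) at `P := (6^g·d)·X^g`, repackaged as ★ R-C2's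
hypothesis hHilb⁺.  What changed against edition 1: the in-flight binder `hHrep` is GONE — the covariant `𝓗` now comes BY NAME from ★ R-C2
(`SiegelFramedCovariantOfHilb`, [MumfordFogartyKirwan1994] Prop. 7.3 / 7.6), its unit hypothesis is the field `hatNormalised` of the
universal triple (edition 2 of ★ `PolarizedAbelianSchemeWithLevel`), the frame-count core `hF9a` is ★
`PolarizedAbelianSchemeWithLevel.exists_threshold_forall_exists_isFrameOn` BY NAME (it supplies `β`), the quasi-projectivity of the
slice-glued scheme and of its universal family is ★ `SiegelFineModuliScheme.isQuasiProjectiveOver_of_charts_of_PL` BY NAME, and the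
only residue of (H-rep) is the Plücker letter `hPL`. -/

section Edition2

open Literature.AlgebraicGeometry.Modules Literature.AlgebraicGeometry.Modules.SerreTwist
open Literature.AlgebraicGeometry.Morphisms Literature.AlgebraicGeometry.Motives.Grassmannian

/-- **[MumfordFogartyKirwan1994] Thm. 7.9 «for `n` large» MODULO THE PRINTED CORES (edition 2).**  For some threshold `β (g, δ)`, at
every level `N ≥ 3` with `β g δ ≤ N` the Siegel moduli functor of type `δ` is represented by a fine moduli scheme `𝓜` over ℚ with
`𝓜.M → Spec ℚ` smooth, `𝓜.M` and the universal abelian scheme's total space quasi-projective over ℚ — GIVEN the four printed cores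
`hII` (F-4: Thm. 6.14, group law as data), `hF3`
(F-3: Cor. 6.8 Zariski-locally), `hPL` (the Plücker letter of the linearly rigidified covariant: every `𝓗 : SiegelFramedCovariant g N δ J`
locally of finite type over ℚ — any two represent the functor `𝓗_{g,d,n} ⊗ ℚ` of Def. 7.6, so `H ≅ H_{g,d,n} ⊗ ℚ` — has `H` quasi-compact
and IMMERSED `ι_H : H → 𝐏^r_ℚ` over its structure map with the class of `ι_H^*𝒪(m)` an integer combination of the determinants
`[det π_*(L^Δ(λ)^{⊗k})]` (Prop. 6.13 (ii)(iv)) and of the classes `[sec_a^* L^Δ(λ)]` along the `2g+1` marked sections (§7.2 (b), (*)):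
EXISTENCE of `ι_H` = Prop. 7.4 (p. 135: `H_{g,d,n}` is quasi-projective with a `PGL(m+1)`-linearised ample sheaf; proof via
`Hilb ↪ Grass`, FGA 221) with Prop. 7.3; the IDENTITY is the intrinsic (`PGL(m+1)`-invariant) form of that linearisation —
`𝒪_{P_m}(1)`-exponents divisible by `m+1 = 6^g·d` — COMPUTED from §7.2 (*) (p. 131), Def. 7.5 (p. 130) and Prop. 6.13 (ii)(iv) (p. 123),
print-derived, not a quotation; tree letter = ★ `SiegelFramedCovariant.PL`), `hF11` (F-11: smoothness of l.f.t. fine moduli schemes,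
[Lan2013PELCompactifications] §2.2.4); the quasi-projectivity core (F-9: Thm. 7.9 «quasi-projective» by the slices of Prop. 7.6, on the
slice-glued scheme and its universal family, consuming `𝓗.PL`) is ★ `SiegelFineModuliScheme.isQuasiProjectiveOver_of_charts_of_PL` BY
NAME, and the Hilbert-scheme core (F-5) is ★ `Motives.exists_grassmannianImmersion_universal_flat_family` BY NAME ([Mumford1966CurvesSurface]
Lect. 15, [MumfordFogartyKirwan1994] Ch. 0 §5 (c)).  Proof: `β :=` ★ `exists_threshold_forall_exists_isFrameOn`; `J := Fin (6^g·d − 1)`; hHilb⁺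
from ⑦b at `P := (6^g·d)·X^g`, `e₁ := 1`; `𝓗 :=` ★ R-C2 `exists_siegelFramedCovariant_locallyOfFiniteType_of_cores hHilb⁺ hII hF3`; ★
`SiegelFramedCovariant.exists_siegelFineModuliScheme` with
`unitH := 𝓗.univ.hatNormalised`, `hcov := β`'s clause, `hdual := hF3`; then ★ `isQuasiProjectiveOver_of_charts_of_PL` (fed `hPL 𝓗`),
★ `locallyOfFiniteType_of_isQuasiProjectiveOver`, `hF11`.
[cite: MumfordFogartyKirwan1994, Ch. 7 §3 Theorem 7.9 with the remark following it and Theorem 7.10 (p. 139)]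
[cite: MumfordFogartyKirwan1994, Ch. 7 §2 Proposition 7.4 (p. 135), §7.2 (*) (p. 131), Definition 7.5 (p. 130), Proposition 7.3 (p. 132), Proposition 7.6 (p. 136)]
[cite: MumfordFogartyKirwan1994, Ch. 6 §2 Proposition 6.13 (ii)(iv) (p. 123), §3 Theorem 6.14 (p. 124), §1 Corollary 6.8 (p. 118)]
[cite: MumfordFogartyKirwan1994, Ch. 0 §5 (c) (p. 23)] [cite: Mumford1966CurvesSurface, Lecture 15 (III.)–(V.) (pp. 106–108)]
[cite: Lan2013PELCompactifications, Thm. 1.4.1.11 (p. 91) and §2.2.4 (pp. 142–150)] -/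
theorem exists_threshold_siegelFineModuliScheme_of_cores'
    -- F-4 ([MumfordFogartyKirwan1994] Thm. 6.14 with the group law as output DATA; letter of ★ `MFKSubfunctorOfHilb` / ★ R-C2 verbatim)
    (hII : ∀ (g : ℕ) ⦃H₁ Z₁ : Scheme.{0}⦄ (p₁ : Z₁ ⟶ H₁) [IsProper p₁] [Smooth p₁] [GeometricallyConnected p₁]
        (f₁ : H₁ ⟶ Spec (.of ℚ)) [LocallyOfFiniteType f₁] (ε₁ : H₁ ⟶ Z₁) (_ : ε₁ ≫ p₁ = 𝟙 H₁),
      ∃ (H₂ : Scheme.{0}) (j₂ : H₂ ⟶ H₁) (_ : IsOpenImmersion j₂) (_ : IsClosed (Set.range j₂))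
        (G : GrpObj (Over.mk (pullback.snd p₁ j₂))),
          (@MonObj.one _ _ _ (Over.mk (pullback.snd p₁ j₂)) G.toMonObj).left ≫ pullback.fst p₁ j₂ = j₂ ≫ ε₁ ∧
          SmoothOfRelativeDimension g (pullback.snd p₁ j₂) ∧
          ∀ ⦃T : Scheme.{0}⦄ (v : T ⟶ H₁),
            (∃! w : T ⟶ H₂, w ≫ j₂ = v) ↔
              ∃ G' : GrpObj (Over.mk (pullback.snd p₁ v)),
                (@MonObj.one _ _ _ (Over.mk (pullback.snd p₁ v)) G'.toMonObj).left ≫ pullback.fst p₁ v = v ≫ ε₁ ∧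
                SmoothOfRelativeDimension g (pullback.snd p₁ v))
    -- F-3 ([MumfordFogartyKirwan1994] Cor. 6.8 Zariski-locally on the base; letter (L))
    (hF3 : ∀ ⦃S : Scheme.{0}⦄ [IsLocallyNoetherian S] (_fS : S ⟶ Spec (.of ℚ)) (A : AbelianSchemeOver S),
      (∀ s : S, ∃ (U : Scheme.{0}) (i : U ⟶ S) (_ : IsOpenImmersion i) (_ : s ∈ Set.range i.base)
        (B : AbelianSchemeOver U) (G : B.X.left ⟶ A.X.left), B.IsBaseChangeVia A i G ∧ IsProjective B.X.hom) →
      Nonempty A.DualPair)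
    -- the Plücker letter of the linearly rigidified covariant ([MumfordFogartyKirwan1994] Prop. 7.4 + §7.2 (*) / Def. 7.5 / Prop. 6.13 (ii)(iv))
    (hPL : ∀ ⦃g N : ℕ⦄ ⦃δ : Fin g → ℕ⦄ ⦃J : Type⦄ [Finite J], 0 < g → IsPolarizationType δ → 3 ≤ N →
      Nat.card J + 1 = 6 ^ g * polarizationDegree δ →
      ∀ 𝓗 : SiegelFramedCovariant g N δ J, LocallyOfFiniteType 𝓗.H.hom → 𝓗.PL)
    -- F-11 (smoothness of l.f.t. fine moduli schemes, [Lan2013PELCompactifications] §2.2.4)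
    (hF11 : ∀ (g N : ℕ) (δ : Fin g → ℕ), 0 < g → IsPolarizationType δ → 3 ≤ N →
      ∀ 𝓜 : SiegelFineModuliScheme g N δ, LocallyOfFiniteType 𝓜.M.hom → Smooth 𝓜.M.hom) :
    ∃ β : (g : ℕ) → (Fin g → ℕ) → ℕ, ∀ (g N : ℕ) (δ : Fin g → ℕ), 0 < g →
      Literature.AlgebraicGeometry.ModuliOfAbelianVarieties.IsPolarizationType δ → 3 ≤ N → β g δ ≤ N →
      ∃ 𝓜 : Literature.AlgebraicGeometry.ModuliOfAbelianVarieties.SiegelFineModuliScheme g N δ,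
        AlgebraicGeometry.Smooth 𝓜.M.hom ∧ Literature.AlgebraicGeometry.HodgeTheory.IsQuasiProjectiveOver 𝓜.M ∧
          Literature.AlgebraicGeometry.HodgeTheory.IsQuasiProjectiveOver
            (CategoryTheory.Over.mk (CategoryTheory.CategoryStruct.comp 𝓜.univ.A.X.hom 𝓜.M.hom) :
              Literature.AlgebraicGeometry.Motives.SchemeOver ℚ) := by
  classical
  -- F-9a BY NAME (★ `SiegelFrameEmbeddingOverField` §4): the threshold `β` and the frame count at every `N ≥ β g δ`
  obtain ⟨β, hβ⟩ := PolarizedAbelianSchemeWithLevel.exists_threshold_forall_exists_isFrameOn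
  refine ⟨β, fun g N δ hg hδ hN hβN => ?_⟩
  haveI : NeZero N := ⟨by omega⟩
  -- `J := Fin (6^g·d − 1)`, so that `#J + 1 = 6^g·d`
  have hJ : Nat.card (Fin (6 ^ g * polarizationDegree δ - 1)) + 1 = 6 ^ g * polarizationDegree δ := by
    have hd : 0 < polarizationDegree δ := Finset.prod_pos fun i _ ↦ hδ.1 i
    rw [Nat.card_eq_fintype_card, Fintype.card_fin]
    exact Nat.sub_add_cancel (Nat.one_le_iff_ne_zero.mpr (Nat.pos_iff_ne_zero.mp (by positivity)))
  -- F-5 BY NAME (★ ⑦b `HilbertImageInGrassmannianUniversalFamily`, edition 4): the Hilbert scheme `Hilb^{(6x)^g d}_{𝐏^J} ↪ Gr` with its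
  -- universal closed flat family, at `P := (6^g·d)·X^g`, `e₁ := 1`, `R e := (6e)^g·d` — repackaged as ★ R-C2's hypothesis hHilb⁺
  have hd : 0 < polarizationDegree δ := Finset.prod_pos fun i _ ↦ hδ.1 i
  have hn : 1 ≤ Nat.card (Fin (6 ^ g * polarizationDegree δ - 1)) := by
    have h6 : 6 ≤ 6 ^ g * polarizationDegree δ :=
      le_mul_of_le_of_one_le (le_of_eq_of_le (pow_one 6).symm (Nat.pow_le_pow_right (by norm_num) hg)) hd
    omega
  obtain ⟨d, k, e₀, he₀, -, hrep, H₁, jG, hjG, hH₁, ZH, iH, hiH, hfam, huniv⟩ :=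
    Literature.AlgebraicGeometry.Motives.exists_grassmannianImmersion_universal_flat_family hn
      (Polynomial.C ((6 ^ g * polarizationDegree δ : ℕ) : ℚ) * Polynomial.X ^ g) 1 (fun e => (6 * e) ^ g * polarizationDegree δ)
      (fun e _ => by push_cast; simp only [Polynomial.eval_mul, Polynomial.eval_pow, Polynomial.eval_C, Polynomial.eval_X]; ring)
  -- the covariant (Prop. 7.3 / 7.6) BY NAME: ★ R-C2 from the cores `hHilb⁺ hII hF3`
  obtain ⟨𝓗, hft⟩ := exists_siegelFramedCovariant_locallyOfFiniteType_of_cores (J := Fin (6 ^ g * polarizationDegree δ - 1))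
    (show N ≠ 0 by omega) hδ hJ ⟨d, k, e₀, he₀, hrep, H₁, jG, hjG, hH₁, ZH, iH, hiH, hfam, huniv⟩ (hII g) hF3
  haveI := 𝓗.isLocallyNoetherian
  -- F-8 (Prop. 7.6 by slices): the fine moduli scheme `A⁰ = ⋃_R V_R` with its chart structure; unit hypothesis = the field `hatNormalised`
  obtain ⟨𝓜, j, hj, hjq, Gc, Ĝc, hchart, hglue, hjcov⟩ := 𝓗.exists_siegelFineModuliScheme hJ hN hδ 𝓗.univ.hatNormalised
    (fun Ω _ _ x Q => hβ g N δ _ hg hδ hN hJ hβN x Q) hF3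
  -- F-9 BY NAME (★ `SiegelModuliQuasiProjective` §6): quasi-projectivity of `𝓜.M` and of the universal total space, fed with `hPL 𝓗`
  obtain ⟨hqM, hqU⟩ := SiegelFineModuliScheme.isQuasiProjectiveOver_of_charts_of_PL g N δ _ hg hδ hN hJ 𝓗 hft
    (hPL hg hδ hN hJ 𝓗 hft) 𝓜 j hj hjq Gc Ĝc hchart hglue hjcov
  -- F-11: smoothness; `𝓜.M` is locally of finite type over ℚ because it is quasi-projective
  haveI : LocallyOfFiniteType 𝓜.M.hom := locallyOfFiniteType_of_isQuasiProjectiveOver hqM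
  exact ⟨𝓜, hF11 g N δ hg hδ hN 𝓜 inferInstance, hqM, hqU⟩

end Edition2

/-! ## Edition 3 — the step-(II) core in its PRINT-EXACT letter `hII''` (projective `p₁`, no closedness conjunct; the (β)+(γ) edition set, row 4)

`exists_threshold_siegelFineModuliScheme_of_cores''`: the same conclusion (`stub_Flarge` verbatim) from the four printed cores with the F-4 core
re-lettered: `hII''` = for every `g`, [MumfordFogartyKirwan1994] Prop. 6.16 ∕ Thm. 6.14 (representability half) ∕ Prop. 7.3 step (II) for a
PROJECTIVE smooth `p₁` with geometrically connected fibres over a `ℚ`-scheme locally of finite type and a section (print states Thm. 6.14 ∕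
Prop. 6.16 for projective abelian schemes; the edition-2 letter `hII` had PROPER `p₁` — stronger than print — and the closedness conjunct of
Thm. 6.14's third step, which no consumer used).  With `∀ (g : ℕ)` in front this is, character for character, the cell's F-4 letter hII″ = the
statement of the tree theorem `Summit.….F4LinearRigidificationII.stub_IIrep'`.  `hF3` (Cor. 6.8 Zariski-locally, letter (L)), `hPL`, `hF11` and
the conclusion are those of edition 2 token for token.  What changed against edition 2: the covariant `𝓗` comes BY NAME from row 3 of the set, ★
`exists_siegelFramedCovariant_locallyOfFiniteType_of_printCores'` ([MumfordFogartyKirwan1994] Prop. 7.3 ∕ 7.6 over the print-exact cores; it consumes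
the Hilbert-scheme core ★ F-5 ⑦b `Motives.exists_grassmannianImmersion_universal_flat_family` ITSELF, so the edition-2 `obtain` of hHilb⁺ disappears),
fed `hII'' g` and the print dual-pair letter hF3′ (Ch. 0 §5 (d) + Cor. 6.8: the dual of a PROJECTIVE abelian scheme over a locally Noetherian
`ℚ`-base) DERIVED from `hF3` on the trivial Zariski cover `𝟙 S` (★ `AbelianSchemeOver.IsBaseChangeVia.refl`) — three lines of plumbing, no
mathematics.  Editions 1–2 above are BYTE-IDENTICAL.  Cell `hodgecm-mathlib`, (β)+(γ) edition set row 4 (F-4 lead memo `EDITION-SET-beta-gamma`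
v1.2; J-P1a-12, F0P1a-plan (g2) 2026-08-30T23:01:55Z; bytes F0P1a-p01 (g2)). -/

section Edition3

open Literature.AlgebraicGeometry.Modules Literature.AlgebraicGeometry.Modules.SerreTwist
open Literature.AlgebraicGeometry.Morphisms Literature.AlgebraicGeometry.Motives.Grassmannian

/-- **[MumfordFogartyKirwan1994] Thm. 7.9 «for `n` large» MODULO THE PRINTED CORES, step (II) PRINT-EXACT (edition 3).**  For some threshold
`β (g, δ)`, at every level `N ≥ 3` with `β g δ ≤ N` the Siegel moduli functor of type `δ` is represented by a fine moduli scheme `𝓜` over ℚ with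
`𝓜.M → Spec ℚ` smooth, `𝓜.M` and the universal abelian scheme's total space quasi-projective over ℚ — GIVEN the four printed cores `hII''` (F-4:
for every `g`, Prop. 6.16 ∕ Thm. 6.14 (representability) ∕ Prop. 7.3 step (II) for a PROJECTIVE smooth `p₁ : Z₁ → H₁` with geometrically
connected fibres over a `ℚ`-scheme locally of finite type and a section `ε₁`: the sub-functor «`Z₁ ×_{H₁} T` carries a group law with unit
`ε₁|_T`, smooth of relative dimension `g`» is represented by an OPEN `j₂ : H₂ ↪ H₁` carrying the universal such law; with `∀ (g : ℕ)` in
front = the cell's letter hII″ = tree `F4LinearRigidificationII.stub_IIrep'` verbatim), `hF3` (F-3: Cor. 6.8 Zariski-locally, letter (L), as in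
edition 2), `hPL` (the Plücker letter of the linearly rigidified covariant, Prop. 7.4 + §7.2 (*) ∕ Def. 7.5 ∕ Prop. 6.13 (ii)(iv), as in edition 2),
`hF11` (F-11: smoothness of l.f.t. fine moduli schemes, [Lan2013PELCompactifications] §2.2.4, as in edition 2).  Conclusion = `stub_Flarge` of
registry 24835 verbatim (= editions 1–2).  Proof: `β :=` ★ `exists_threshold_forall_exists_isFrameOn`; `J := Fin (6^g·d − 1)` (`#J ≥ 1` for
`g ≥ 1`); hF3′ from `hF3` on the trivial cover (★ `AbelianSchemeOver.IsBaseChangeVia.refl`); `𝓗 :=` ★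
`exists_siegelFramedCovariant_locallyOfFiniteType_of_printCores' … (hII'' g) hF3′` (row 3 of the (β)+(γ) set, over ★ R-A ed. 4 and ★ FILE 2
ed. 2); ★ `SiegelFramedCovariant.exists_siegelFineModuliScheme` with `unitH := 𝓗.univ.hatNormalised`, `hcov := β`'s clause, `hdual := hF3`; then ★
`isQuasiProjectiveOver_of_charts_of_PL` (fed `hPL 𝓗`), ★ `locallyOfFiniteType_of_isQuasiProjectiveOver`, `hF11`.
[cite: MumfordFogartyKirwan1994, Ch. 7 §3 Theorem 7.9 with the remark following it and Theorem 7.10 (p. 139)]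
[cite: MumfordFogartyKirwan1994, Ch. 7 §2 Proposition 7.4 (p. 135), §7.2 (*) (p. 131), Definition 7.5 (p. 130), Proposition 7.3 (p. 132), Proposition 7.6 (p. 136)]
[cite: MumfordFogartyKirwan1994, Ch. 6 §2 Proposition 6.13 (ii)(iv) (p. 123), §3 Theorem 6.14 (p. 124), Proposition 6.16 (p. 126), §1 Corollary 6.8 (p. 118)]
[cite: MumfordFogartyKirwan1994, Ch. 0 §5 (c) (p. 23), (d) (pp. 24–25)] [cite: Mumford1966CurvesSurface, Lecture 15 (III.)–(V.) (pp. 106–108)]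
[cite: Lan2013PELCompactifications, Thm. 1.4.1.11 (p. 91) and §2.2.4 (pp. 142–150)] -/
theorem exists_threshold_siegelFineModuliScheme_of_cores''
    -- F-4 PRINT-EXACT (hII″ under `∀ (g : ℕ)` = tree `F4LinearRigidificationII.stub_IIrep'` verbatim: [MumfordFogartyKirwan1994] Prop. 6.16 ∕ Thm. 6.14 ∕ Prop. 7.3 (II) for PROJECTIVE `p₁`, group law as output DATA, NO `IsClosed (Set.range j₂)`)
    (hII'' : ∀ (g : ℕ) ⦃H₁ Z₁ : Scheme.{0}⦄ (p₁ : Z₁ ⟶ H₁) [IsProper p₁] [Smooth p₁] [GeometricallyConnected p₁]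
        (_ : IsProjective p₁)
        (f₁ : H₁ ⟶ Spec (.of ℚ)) [LocallyOfFiniteType f₁] (ε₁ : H₁ ⟶ Z₁) (_ : ε₁ ≫ p₁ = 𝟙 H₁),
      ∃ (H₂ : Scheme.{0}) (j₂ : H₂ ⟶ H₁) (_ : IsOpenImmersion j₂)
        (G : GrpObj (Over.mk (pullback.snd p₁ j₂))),
          (@MonObj.one _ _ _ (Over.mk (pullback.snd p₁ j₂)) G.toMonObj).left ≫ pullback.fst p₁ j₂ = j₂ ≫ ε₁ ∧
          SmoothOfRelativeDimension g (pullback.snd p₁ j₂) ∧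
          ∀ ⦃T : Scheme.{0}⦄ (v : T ⟶ H₁),
            (∃! w : T ⟶ H₂, w ≫ j₂ = v) ↔
              ∃ G' : GrpObj (Over.mk (pullback.snd p₁ v)),
                (@MonObj.one _ _ _ (Over.mk (pullback.snd p₁ v)) G'.toMonObj).left ≫ pullback.fst p₁ v = v ≫ ε₁ ∧
                SmoothOfRelativeDimension g (pullback.snd p₁ v))
    -- F-3 ([MumfordFogartyKirwan1994] Cor. 6.8 Zariski-locally on the base; letter (L), as in edition 2)
    (hF3 : ∀ ⦃S : Scheme.{0}⦄ [IsLocallyNoetherian S] (_fS : S ⟶ Spec (.of ℚ)) (A : AbelianSchemeOver S),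
      (∀ s : S, ∃ (U : Scheme.{0}) (i : U ⟶ S) (_ : IsOpenImmersion i) (_ : s ∈ Set.range i.base)
        (B : AbelianSchemeOver U) (G : B.X.left ⟶ A.X.left), B.IsBaseChangeVia A i G ∧ IsProjective B.X.hom) →
      Nonempty A.DualPair)
    -- the Plücker letter of the linearly rigidified covariant ([MumfordFogartyKirwan1994] Prop. 7.4 + §7.2 (*) / Def. 7.5 / Prop. 6.13 (ii)(iv); as in edition 2)
    (hPL : ∀ ⦃g N : ℕ⦄ ⦃δ : Fin g → ℕ⦄ ⦃J : Type⦄ [Finite J], 0 < g → IsPolarizationType δ → 3 ≤ N →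
      Nat.card J + 1 = 6 ^ g * polarizationDegree δ →
      ∀ 𝓗 : SiegelFramedCovariant g N δ J, LocallyOfFiniteType 𝓗.H.hom → 𝓗.PL)
    -- F-11 (smoothness of l.f.t. fine moduli schemes, [Lan2013PELCompactifications] §2.2.4; as in edition 2)
    (hF11 : ∀ (g N : ℕ) (δ : Fin g → ℕ), 0 < g → IsPolarizationType δ → 3 ≤ N →
      ∀ 𝓜 : SiegelFineModuliScheme g N δ, LocallyOfFiniteType 𝓜.M.hom → Smooth 𝓜.M.hom) :
    ∃ β : (g : ℕ) → (Fin g → ℕ) → ℕ, ∀ (g N : ℕ) (δ : Fin g → ℕ), 0 < g →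
      Literature.AlgebraicGeometry.ModuliOfAbelianVarieties.IsPolarizationType δ → 3 ≤ N → β g δ ≤ N →
      ∃ 𝓜 : Literature.AlgebraicGeometry.ModuliOfAbelianVarieties.SiegelFineModuliScheme g N δ,
        AlgebraicGeometry.Smooth 𝓜.M.hom ∧ Literature.AlgebraicGeometry.HodgeTheory.IsQuasiProjectiveOver 𝓜.M ∧
          Literature.AlgebraicGeometry.HodgeTheory.IsQuasiProjectiveOver
            (CategoryTheory.Over.mk (CategoryTheory.CategoryStruct.comp 𝓜.univ.A.X.hom 𝓜.M.hom) :
              Literature.AlgebraicGeometry.Motives.SchemeOver ℚ) := by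
  classical
  -- F-9a BY NAME (★ `SiegelFrameEmbeddingOverField` §4): the threshold `β` and the frame count at every `N ≥ β g δ`
  obtain ⟨β, hβ⟩ := PolarizedAbelianSchemeWithLevel.exists_threshold_forall_exists_isFrameOn
  refine ⟨β, fun g N δ hg hδ hN hβN => ?_⟩
  haveI : NeZero N := ⟨by omega⟩
  -- `J := Fin (6^g·d − 1)`, so that `#J + 1 = 6^g·d` and `#J ≥ 1`
  have hd : 0 < polarizationDegree δ := Finset.prod_pos fun i _ ↦ hδ.1 i
  have hJ : Nat.card (Fin (6 ^ g * polarizationDegree δ - 1)) + 1 = 6 ^ g * polarizationDegree δ := by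
    rw [Nat.card_eq_fintype_card, Fintype.card_fin]
    exact Nat.sub_add_cancel (Nat.one_le_iff_ne_zero.mpr (Nat.pos_iff_ne_zero.mp (by positivity)))
  have hn : 1 ≤ Nat.card (Fin (6 ^ g * polarizationDegree δ - 1)) := by
    have h6 : 6 ≤ 6 ^ g * polarizationDegree δ :=
      le_mul_of_le_of_one_le (le_of_eq_of_le (pow_one 6).symm (Nat.pow_le_pow_right (by norm_num) hg)) hd
    omega
  -- the print dual-pair letter hF3′ (Ch. 0 §5 (d) + Cor. 6.8 for a PROJECTIVE abelian scheme) from the Zariski-local letter (L) on the trivial cover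
  have hF3' : ∀ ⦃S : Scheme.{0}⦄ [IsLocallyNoetherian S] (_ : S ⟶ Spec (.of ℚ)) (A : AbelianSchemeOver S),
      IsProjective A.X.hom → Nonempty A.DualPair := fun S _ fS A hA =>
    hF3 fS A fun s => ⟨S, 𝟙 S, inferInstance, ⟨s, rfl⟩, A, 𝟙 A.X.left, AbelianSchemeOver.IsBaseChangeVia.refl A, hA⟩
  -- the covariant (Prop. 7.3 / 7.6) BY NAME over the PRINT-EXACT cores: ★ row 3 `SiegelFramedCovariantOfHilbPrint` (it consumes the Hilbert-scheme core ⑦b itself)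
  obtain ⟨𝓗, hft⟩ := exists_siegelFramedCovariant_locallyOfFiniteType_of_printCores' (J := Fin (6 ^ g * polarizationDegree δ - 1))
    (show N ≠ 0 by omega) hδ hJ hn (hII'' g) hF3'
  haveI := 𝓗.isLocallyNoetherian
  -- F-8 (Prop. 7.6 by slices): the fine moduli scheme `A⁰ = ⋃_R V_R` with its chart structure; unit hypothesis = the field `hatNormalised`
  obtain ⟨𝓜, j, hj, hjq, Gc, Ĝc, hchart, hglue, hjcov⟩ := 𝓗.exists_siegelFineModuliScheme hJ hN hδ 𝓗.univ.hatNormalised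
    (fun Ω _ _ x Q => hβ g N δ _ hg hδ hN hJ hβN x Q) hF3
  -- F-9 BY NAME (★ `SiegelModuliQuasiProjective` §6): quasi-projectivity of `𝓜.M` and of the universal total space, fed with `hPL 𝓗`
  obtain ⟨hqM, hqU⟩ := SiegelFineModuliScheme.isQuasiProjectiveOver_of_charts_of_PL g N δ _ hg hδ hN hJ 𝓗 hft
    (hPL hg hδ hN hJ 𝓗 hft) 𝓜 j hj hjq Gc Ĝc hchart hglue hjcov
  -- F-11: smoothness; `𝓜.M` is locally of finite type over ℚ because it is quasi-projective
  haveI : LocallyOfFiniteType 𝓜.M.hom := locallyOfFiniteType_of_isQuasiProjectiveOver hqM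
  exact ⟨𝓜, hF11 g N δ hg hδ hN 𝓜 inferInstance, hqM, hqU⟩

end Edition3

end Literature.AlgebraicGeometry.ModuliOfAbelianVarieties

end
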